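import Summits.ABC.ABC.Theses.IsogenyGlueCongruence
import Literature.AlgebraicGeometry.Motives.AbelianVarietyBaseChange

/-!
# Sketch — crux-ideate stmt-ABC-2157 (TorsionSharingPrimeBound), ideator 3 (gen 2), round 1
# Idea `absolute-size-collapse`: first lemma and the typed transfer C⁺

Everything here is a `def … : Prop` (statements only) except two one-line sanity theorems.
-/

noncomputable section

set_option linter.dupNamespace false

open CategoryTheory
open Literature.AlgebraicGeometry.Motives
open Literature.NumberTheory.EllipticCurves.ModularForms
open Summit.ABC.ABC.Theses.IsogenyGlueCongruence

namespace Summit.ABC.ABC.Cruxes.TorsionSharingPrimeBound.AbsoluteSizeCollapse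

/-- **Geometric rank one.** The inclusion-type datum `E, B` is *absolute*: after ANY extension of
scalars `L / ℚ`, two homomorphisms `E_L ⟶ B_L` are `ℤ`-linearly dependent (so `Hom_{ℚ̄}(E, B)` has
rank `≤ 1`). This is the hypothesis that kills every VISIBLE gluing (Mazur–Rubin–Silverberg twists
`M ⊗ E`, Weil restrictions, the dihedral totally-real variant): those have `rank Hom_{ℚ̄}(E, B) = rank M ≥ 2`.
For `B = J₀(N)`, `N` squarefree, and `E` of conductor `N` it HOLDS (multiplicity one + no CM + no inner
twists at squarefree level, Ribet 1980; see the idea card). [folklore] -/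
def GeomRankOne (E B : AbelianVariety.{0} ℚ) : Prop :=
  ∀ (L : Type) [Field L] [Algebra ℚ L] (α₁ α₂ : E.baseChange L ⟶ B.baseChange L),
    ∃ a b : ℤ, (a ≠ 0 ∨ b ≠ 0) ∧ a • α₁ = b • α₂

/-- **C⁺, the transfer (typable, semi-uniform form: the partner's height dropped exactly as in the
route's lever `EllipticGluingPrimeBound`).** For a geometrically rank-one pair `(E, B)` with `E` an
AV-model of the elliptic curve `W`, the LEAST POSITIVE `E`-multiplier `n` of `B`
(`α ≫ β = n • 𝟙 E`, and every positive multiplier is `≥ n`) satisfies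
`n ≤ C · (dim B · max(1, h_F(W)))^κ` with ABSOLUTE `κ, C`.  This is the SIZE form the route text
rejected for arbitrary `B` (composite cyclotomic gluing); `GeomRankOne` removes that objection, and
the size form implies the prime form `U` restricted to absolute gluings. [conjecture] -/
def AbsoluteGluingExponentBound : Prop :=
  ∃ κ C : ℝ, 0 ≤ κ ∧ ∀ (W : WeierstrassCurve ℚ) [W.IsElliptic] (E B : AbelianVariety.{0} ℚ)
    (e : E.geomPoints ≃+ W.geomPoints),
    (∀ (σ : Field.absoluteGaloisGroup ℚ) (P : E.geomPoints), e (σ • P) = σ • e P) →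
    GeomRankOne E B →
    ∀ (α : E ⟶ B) (β : B ⟶ E) (n : ℤ), 0 < n → α ≫ β = n • 𝟙 E →
    (∀ (α' : E ⟶ B) (β' : B ⟶ E) (n' : ℤ), 0 < n' → α' ≫ β' = n' • 𝟙 E → n ≤ n') →
    (n : ℝ) ≤ C * ((B.dim : ℝ) * max 1 W.stableFaltingsHeight) ^ κ

/-- **Instance datum (fact-shaped, = the route's support item `ModularJacobianMultipliers` plus
geometric rank one).** For semistable `W` of conductor `N` there are a parametrisation datum `D`
of minimal degree, `E = W` and `J = J₀(N)` as abelian varieties over `ℚ` with `dim J ≤ N²`,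
`GeomRankOne E J` (THEOREM for squarefree `N`: `Hom_{ℚ̄}(E, J₀(N)) = ℤ·φ^∨`), a positive
`E`-multiplier, and `m_E = D.modularDegree` dividing every multiplier. [folklore] -/
def ModularJacobianRankOne : Prop :=
  ∀ (W : WeierstrassCurve ℚ) [W.IsElliptic] [W.IsGloballyMinimal] [NeZero (W.conductorNorm ℤ)],
    W.IsSemistable ℤ →
    ∃ (D : ModularParametrizationData W (W.conductorNorm ℤ)) (E J : AbelianVariety.{0} ℚ)
      (e : E.geomPoints ≃+ W.geomPoints),
      (∀ (σ : Field.absoluteGaloisGroup ℚ) (P : E.geomPoints), e (σ • P) = σ • e P) ∧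
      (J.dim : ℝ) ≤ (W.conductorNorm ℤ : ℝ) ^ 2 ∧ GeomRankOne E J ∧
      (∃ (α : E ⟶ J) (β : J ⟶ E) (n : ℤ), 0 < n ∧ α ≫ β = n • 𝟙 E) ∧
      (∀ (α : E ⟶ J) (β : J ⟶ E) (n : ℤ), α ≫ β = n • 𝟙 E → (D.modularDegree : ℤ) ∣ n)

/-- The polynomial modular-degree statement for semistable curves (Frey's height conjecture in
degree form) — VERBATIM the antecedent of the route decl `SharpDegreeOfPolyDegree` and the
consequent of `PolyDegreeOfBoundedPrimes`. [conjecture] -/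
def PolyModularDegree : Prop :=
  ∃ κ C : ℝ, ∀ (W : WeierstrassCurve ℚ) [W.IsElliptic] [W.IsGloballyMinimal] [NeZero (W.conductorNorm ℤ)],
    W.IsSemistable ℤ → ∃ D : Literature.NumberTheory.EllipticCurves.ModularForms.ModularParametrizationData W (W.conductorNorm ℤ),
      (D.modularDegree : ℝ) ≤ C * (W.conductorNorm ℤ : ℝ) ^ κ

/-- **FIRST LEMMA of the line (instance glue; provable now, ~40 lines of `Real.rpow` bookkeeping,
shape of the PROVED route item `DegreePrimesOfGluingBound`):** the size conjecture for absolute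
gluings, the modular rank-one instance and `h_F(W) ≤ c N²` give `m_E ≤ C' N^{4κ}`:
take `D, E, J` from the instance, let `n₀` be the least positive multiplier (exists: the positive
multipliers form a non-empty set of naturals), then `m_E ∣ n₀`, `m_E ≤ n₀ ≤ C (N² · max(1, cN²))^κ`. [folklore] -/
def PolyDegreeOfAbsoluteSize : Prop :=
  AbsoluteGluingExponentBound → ModularJacobianRankOne → SemistableHeightPolyBound → PolyModularDegree


/-- **The first lemma, PROVED** (so the line's only open content is C⁺ and the instance facts). [folklore] -/
theorem polyDegreeOfAbsoluteSize : PolyDegreeOfAbsoluteSize := by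
  rintro ⟨κ, C, hκ, H⟩ hJ ⟨c, hc⟩
  refine ⟨4 * κ, |C| * (max 1 c) ^ κ, fun W _ _ _ hW => ?_⟩
  obtain ⟨D, E, J, e, he, hdim, hrank, ⟨α, β, n, hn, hαβ⟩, hdvd⟩ := hJ W hW
  classical
  -- positive multipliers, as naturals
  let P : ℕ → Prop := fun m => 0 < m ∧ ∃ (α' : E ⟶ J) (β' : J ⟶ E), α' ≫ β' = ((m : ℕ) : ℤ) • 𝟙 E
  have hP : ∃ m, P m := by
    refine ⟨n.toNat, Int.lt_toNat.mpr (by simpa using hn), α, β, ?_⟩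
    rw [Int.toNat_of_nonneg hn.le]; exact hαβ
  obtain ⟨hn₀, α₀, β₀, h₀⟩ : P (Nat.find hP) := Nat.find_spec hP
  set n₀ : ℕ := Nat.find hP with hn₀def
  have hmin : ∀ (α' : E ⟶ J) (β' : J ⟶ E) (n' : ℤ), 0 < n' → α' ≫ β' = n' • 𝟙 E → (n₀ : ℤ) ≤ n' := by
    intro α' β' n' hn' h'
    have hPn' : P n'.toNat := by
      refine ⟨Int.lt_toNat.mpr (by simpa using hn'), α', β', ?_⟩
      rw [Int.toNat_of_nonneg hn'.le]; exact h'
    have hle : n₀ ≤ n'.toNat := Nat.find_min' hP hPn'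
    calc (n₀ : ℤ) ≤ (n'.toNat : ℤ) := by exact_mod_cast hle
      _ = n' := Int.toNat_of_nonneg hn'.le
  have hn₀Z : (0 : ℤ) < (n₀ : ℤ) := by exact_mod_cast hn₀
  have hbound := H W E J e he hrank α₀ β₀ (n₀ : ℤ) hn₀Z h₀ hmin
  have hmE : (D.modularDegree : ℤ) ≤ (n₀ : ℤ) := Int.le_of_dvd hn₀Z (hdvd α₀ β₀ _ h₀)
  refine ⟨D, ?_⟩
  -- real-number bookkeeping
  have hN1 : (1 : ℝ) ≤ (W.conductorNorm ℤ : ℝ) := by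
    exact_mod_cast Nat.one_le_iff_ne_zero.mpr (NeZero.ne _)
  have hN0 : (0 : ℝ) ≤ (W.conductorNorm ℤ : ℝ) := by positivity
  have hh : W.stableFaltingsHeight ≤ c * (W.conductorNorm ℤ : ℝ) ^ 2 := hc W hW
  have hN2 : (1 : ℝ) ≤ (W.conductorNorm ℤ : ℝ) ^ 2 := one_le_pow₀ hN1
  have hmax : max 1 W.stableFaltingsHeight ≤ max 1 c * (W.conductorNorm ℤ : ℝ) ^ 2 := by
    refine max_le ?_ ?_
    · calc (1 : ℝ) = 1 * 1 := by ring
        _ ≤ max 1 c * (W.conductorNorm ℤ : ℝ) ^ 2 :=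
          mul_le_mul (le_max_left _ _) hN2 (by norm_num) (by positivity)
    · exact hh.trans (mul_le_mul_of_nonneg_right (le_max_right _ _) (by positivity))
  have hX0 : (0 : ℝ) ≤ (J.dim : ℝ) * max 1 W.stableFaltingsHeight := by positivity
  have hX : (J.dim : ℝ) * max 1 W.stableFaltingsHeight ≤ max 1 c * (W.conductorNorm ℤ : ℝ) ^ 4 := by
    calc (J.dim : ℝ) * max 1 W.stableFaltingsHeight
        ≤ (W.conductorNorm ℤ : ℝ) ^ 2 * (max 1 c * (W.conductorNorm ℤ : ℝ) ^ 2) :=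
          mul_le_mul hdim hmax (by positivity) (by positivity)
      _ = max 1 c * (W.conductorNorm ℤ : ℝ) ^ 4 := by ring
  have hpow : ((W.conductorNorm ℤ : ℝ) ^ 4) ^ κ = (W.conductorNorm ℤ : ℝ) ^ (4 * κ) := by
    rw [show ((W.conductorNorm ℤ : ℝ) ^ 4) = (W.conductorNorm ℤ : ℝ) ^ ((4 : ℕ) : ℝ) from
      (Real.rpow_natCast _ 4).symm, ← Real.rpow_mul hN0]
    norm_num
  calc (D.modularDegree : ℝ) ≤ (n₀ : ℝ) := by exact_mod_cast hmE
    _ ≤ C * ((J.dim : ℝ) * max 1 W.stableFaltingsHeight) ^ κ := by exact_mod_cast hbound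
    _ ≤ |C| * ((J.dim : ℝ) * max 1 W.stableFaltingsHeight) ^ κ :=
        mul_le_mul_of_nonneg_right (le_abs_self C) (by positivity)
    _ ≤ |C| * (max 1 c * (W.conductorNorm ℤ : ℝ) ^ 4) ^ κ :=
        mul_le_mul_of_nonneg_left (Real.rpow_le_rpow hX0 hX hκ) (abs_nonneg C)
    _ = |C| * (max 1 c) ^ κ * (W.conductorNorm ℤ : ℝ) ^ (4 * κ) := by
        rw [Real.mul_rpow (by positivity) (by positivity), hpow]; ring

/-- Sanity 1: the polynomial degree statement closes crux A (`DegreePrimesPolyBounded`) — a prime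
factor of a positive integer is at most the integer. [folklore] -/
theorem degreePrimesPolyBounded_of_poly (h : PolyModularDegree) : DegreePrimesPolyBounded := by
  obtain ⟨κ, C, h⟩ := h
  refine ⟨κ, C, fun W _ _ _ hW => ?_⟩
  obtain ⟨D, hD⟩ := h W hW
  refine ⟨D, fun ℓ _ hdvd => le_trans ?_ hD⟩
  exact_mod_cast Nat.le_of_dvd D.deg_pos hdvd

/-- Sanity 2: it is literally the antecedent of the route's residual crux R, so together with R
it gives the target X (and then `FrameOverPetersson` gives ABC). [folklore] -/
theorem target_of_poly (h : PolyModularDegree) (hR : SharpDegreeOfPolyDegree) :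
    SemistableDegreeConjecture := hR h

/-- Sanity 3 (the prime form is a shadow of the size form): C⁺ implies the route lever `U`
RESTRICTED to geometrically rank-one pairs. Stated, not proved here (needs: the multipliers of a
rank-one pair form the ideal `n₀ℤ`). [folklore] -/
def AbsoluteU : Prop :=
  ∃ κ C : ℝ, 0 ≤ κ ∧ ∀ (W : WeierstrassCurve ℚ) [W.IsElliptic] (E B : AbelianVariety.{0} ℚ)
    (e : E.geomPoints ≃+ W.geomPoints),
    (∀ (σ : Field.absoluteGaloisGroup ℚ) (P : E.geomPoints), e (σ • P) = σ • e P) →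
    GeomRankOne E B → ∀ ℓ : ℕ, ℓ.Prime →
    (∃ (α : E ⟶ B) (β : B ⟶ E) (n : ℤ), n ≠ 0 ∧ α ≫ β = n • 𝟙 E) →
    (∀ (α : E ⟶ B) (β : B ⟶ E) (n : ℤ), α ≫ β = n • 𝟙 E → (ℓ : ℤ) ∣ n) →
    (ℓ : ℝ) ≤ C * ((B.dim : ℝ) * max 1 W.stableFaltingsHeight) ^ κ

def absoluteU_of_size : Prop := AbsoluteGluingExponentBound → AbsoluteU

end Summit.ABC.ABC.Cruxes.TorsionSharingPrimeBound.AbsoluteSizeCollapse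

end
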